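import Summits.QuantumFields.YangMills.Theorems.SwapVirialDeficitBlowUpGnomonicBFibreRescaledFloor
import Summits.QuantumFields.YangMills.Theorems.SwapVirialDeficitQuantitativeLaplaceDiagonalRescaleChart
import Literature.Analysis.Asymptotics.LaplaceMethodChartComposition
import HarnessLib

/-!
# STUB (S-B) OF SKELETON ➎, SOCKETS part 2b: THE RESCALED B-CHART `Ψ′_B(u,y) = gnoFibreBEquiv (u, gnoScaleB u y)` — tube chart identity and packaged sockets
# (free-hands support of ⟨stmt-QuantumFields-24197⟩ `SwapVirialDeficit.SwapGluedStiffness` ∕ ⟨24194⟩; cell ym-idea-1, LEAD memo7 §E(3); the B-twin of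
# ✓`…BlowUpGnomonicFibreRescaledSockets`)

* §1 the rescaled B-chart: `measurable_gnoScaleBChart`, `gnoScaleBChart_injective`, `gnoScaleBChart_surjective`, `gnoScaleBChart_image_prod_univ` (the cylinder over a base
  set `S` is `{(η_x 1, η_x 2) ∈ S}` — rescaling does not move the base), `exists_of_mem_cylinderB_not_mem_scaledTube`; ★ `volume_muB_restrict_scaledBTube_eq_map` — the
  TUBE CHART IDENTITY of `μ_B = vol·J_B` (`J_B(δ,η) = ((1+δ²)⁻¹)²ρ(η)`) under `Ψ′_B` over any measurable base set `S`, density `(Π_i|c_i(u)|)·J_B(Ψ′_B(u,y))`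
  (lit ✓`chart_comp_of_injOn_ofReal` ∘ ✓`prod_volume_eq_map_diagScale` ∘ ✓`volume_withDensity_eq_map_gnoFibreBEquiv`);
* §2 ★★★ `bFibre_rescaled_sockets (ε) (hz) (hε) (hτ) (hτ1)` — ONE existential: operators `A′_u = D_u A_u D_u` on `V_B` (`A_u` = ✓`exists_bFibreHessian` at `gnoBaseB u`,
  `D_u` = ✓`gnoScaleBLin u`): symmetric; `(u,y) ↦ ⟪A′_u y,y⟫` measurable; RAY identity `⟪A′_u y,y⟫ = (d²∕ds²)F_B(gnoBaseB u + s·gnoFibreBEmb(gnoScaleB u y))|₀`;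
  UNIFORM COERCIVITY `τ²∕((1+τ²)·12375·L¹⁰)·‖y‖² ≤ ⟪A′_u y,y⟫` for `τ² ≤ |u|²` (✓`bFibQ_gnoScaleB_ge`); the cubic datum `F_B(Ψ′_B(u,y)) − 0 = ½⟪A′_u y,y⟫ + ρ′(u,y)` with
  `|ρ′(u,y)| ≤ 1136016L⁴‖gnoScaleB u y‖³` (plain letters, ✓`bFibreHessian_base_cubic`; the `|u|`-UNIFORM bound `≤ A₃‖y‖³` waits for g47's K7e), `ρ′` measurable; the
  amplitude `(Π|c_i(u)|)·J_B(Ψ′_B(u,y)) = w₀(u)(1 + e′(u,y))` with `w₀(u) = w(0,u₁,u₂)√(1+|u|²)` and `e′(u,y) = g(y) − 1`, `|e′| ≤ 2R‖y‖` on `‖y‖ ≤ R`, `e′` measurable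
  (✓`bDensity_rescaled_eq`, ✓`bFibreWeight_bounds`, ✓`bBaseWeight_facts`).

What is NOT here: the far floor on the B-tube off the scaled tube (w3-type global floor), the two-sided law `bTube_fibred_scaled_cylinder` and its reading on
`chartMeasure L` over ✓`BTube L τ` (✓`lintegral_chartMeasure_hubCot`), `det A′`.  HONEST LABEL: (S-B), (S-core), (S-001), ⟨24197⟩ ∕ ⟨24194⟩ OPEN; own crux ⟨22884⟩ OPEN
(blocked-on ⟨19935⟩); the Yang–Mills mass gap is NOT proved; no summit is proved by a line.  THEOREMS ONLY (0 `def`, 0 `sorry`), standard axioms.  Width seat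
ym-line-sfw-p2-w2 g59 (cell ym-idea-1, free hands), `--supports stmt-QuantumFields-24197`.  References: [cite: Luscher1983, §2]; [cite: Breitung1994, §2.3 Definitions 4–5];
[folklore].
-/

set_option autoImplicit false
set_option synthInstance.maxSize 1024

noncomputable section

open MeasureTheory Quaternion Set Metric
open scoped BigOperators Quaternion InnerProductSpace ENNReal
open Literature.MathematicalPhysics.QuantumFieldTheory hiding SU2
open Literature.MathematicalPhysics.QuantumLattice

namespace Summit.QuantumFields.YangMills.Theorems.SwapVirialDeficit.BlowUpRing

open Summit.QuantumFields.YangMills.Theorems.FemtoTransferGap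
open Summit.QuantumFields.YangMills.Theorems.FemtoTransferGap.TT
open Summit.QuantumFields.YangMills.Theorems.VirialFluxGap.RingDeficit
open Summit.QuantumFields.YangMills.Theorems.SwapVirialDeficit.SwapRing
open Summit.QuantumFields.YangMills.Theorems.SwapVirialDeficit.Gnomonic (normSq3 normSq3_nonneg gnomonicWeight gnomonicWeight_pos)
open Summit.QuantumFields.YangMills.Theorems.QuantitativeLaplace (prod_volume_eq_map_diagScale diagScale_injective measurableSet_image_diagScale
  restrict_image_eq_map_of_eq_map)

variable {L : ℕ} [NeZero L]

/-! ## §1 The rescaled B-chart and its tube chart identity -/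

/-- The rescaled B-chart `Ψ′_B(u, y) = gnoFibreBEquiv (u, gnoScaleB u y)` is measurable. [folklore] -/
theorem measurable_gnoScaleBChart : Measurable fun q : (ℝ × ℝ) × GnoFibreB L => gnoFibreBEquiv (q.1, gnoScaleB q.1 q.2) := by
  have h := Measurable.comp (measurable_gnoFibreBEquiv (L := L)) (measurable_fst.prodMk (measurable_gnoScaleB_prod (L := L)))
  exact h

/-- `Ψ′_B` is injective. [folklore] -/
theorem gnoScaleBChart_injective : Function.Injective fun q : (ℝ × ℝ) × GnoFibreB L => gnoFibreBEquiv (q.1, gnoScaleB q.1 q.2) := by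
  intro q q' h
  have h1 : (q.1, gnoScaleB q.1 q.2) = (q'.1, gnoScaleB q'.1 q'.2) := (gnoFibreBEquiv (L := L)).injective h
  exact diagScale_injective (c := fun (u : ℝ × ℝ) (i : GnoFibreBIdx L) => gnoFibreBScale (L := L) u i) (fun u i => (gnoFibreBScale_pos u i).ne') h1

/-- `Ψ′_B` is surjective (each `D_u` is invertible). [folklore] -/
theorem gnoScaleBChart_surjective : Function.Surjective fun q : (ℝ × ℝ) × GnoFibreB L => gnoFibreBEquiv (q.1, gnoScaleB q.1 q.2) := by
  intro p
  obtain ⟨⟨u, y'⟩, rfl⟩ := (gnoFibreBEquiv (L := L)).surjective p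
  refine ⟨(u, (WithLp.toLp 2 fun i => (gnoFibreBScale u i)⁻¹ * y' i : GnoFibreB L)), ?_⟩
  show gnoFibreBEquiv (u, gnoScaleB u (WithLp.toLp 2 fun i => (gnoFibreBScale u i)⁻¹ * y' i : GnoFibreB L)) = gnoFibreBEquiv (u, y')
  congr 2
  exact PiLp.ext fun i => by rw [gnoScaleB_apply, PiLp.toLp_apply, mul_inv_cancel_left₀ (gnoFibreBScale_pos u i).ne']

/-- The CYLINDER of the rescaled chart over a base set `S` is the plain cylinder `{(η_x 1, η_x 2) ∈ S}` (the rescaling does not move the base). [folklore] -/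
theorem gnoScaleBChart_image_prod_univ (S : Set (ℝ × ℝ)) :
    (fun q : (ℝ × ℝ) × GnoFibreB L => gnoFibreBEquiv (q.1, gnoScaleB q.1 q.2)) '' (S ×ˢ (univ : Set (GnoFibreB L))) =
      {p : ℝ × GnoCoord L | (p.2.1.1 1, p.2.1.1 2) ∈ S} := by
  rw [← gnoFibreBEquiv_image_prod_univ]
  ext p
  constructor
  · rintro ⟨q, hq, rfl⟩
    exact ⟨(q.1, gnoScaleB q.1 q.2), ⟨(mem_prod.1 hq).1, mem_univ _⟩, rfl⟩
  · rintro ⟨q, hq, rfl⟩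
    obtain ⟨q', hq'⟩ := gnoScaleBChart_surjective (L := L) (gnoFibreBEquiv q)
    have h1 : (q'.1, gnoScaleB q'.1 q'.2) = q := (gnoFibreBEquiv (L := L)).injective hq'
    refine ⟨q', ⟨?_, mem_univ _⟩, hq'⟩
    have h2 : q'.1 = q.1 := by have h3 := congrArg Prod.fst h1; exact h3
    rw [mem_prod] at hq
    show q'.1 ∈ S
    rw [h2]; exact hq.1

/-- In the cylinder but off the scaled tube of radius `R`: `p = Ψ′_B(u, y)` with `u ∈ S` and `R < ‖y‖`. [folklore] -/
theorem exists_of_mem_cylinderB_not_mem_scaledTube {S : Set (ℝ × ℝ)} {R : ℝ} {p : ℝ × GnoCoord L}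
    (hp : p ∈ (fun q : (ℝ × ℝ) × GnoFibreB L => gnoFibreBEquiv (q.1, gnoScaleB q.1 q.2)) '' (S ×ˢ (univ : Set (GnoFibreB L))))
    (hpT : p ∉ (fun q : (ℝ × ℝ) × GnoFibreB L => gnoFibreBEquiv (q.1, gnoScaleB q.1 q.2)) '' (S ×ˢ closedBall (0 : GnoFibreB L) R)) :
    ∃ u ∈ S, ∃ y : GnoFibreB L, R < ‖y‖ ∧ p = gnoFibreBEquiv (u, gnoScaleB u y) := by
  obtain ⟨q, hq, rfl⟩ := hp
  refine ⟨q.1, (mem_prod.1 hq).1, q.2, ?_, rfl⟩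
  by_contra h
  exact hpT ⟨q, ⟨(mem_prod.1 hq).1, mem_closedBall_zero_iff.2 (le_of_not_gt h)⟩, rfl⟩

/-- ★ **THE TUBE CHART IDENTITY OF THE RESCALED B-CHART** over a measurable base set `S`: the scaled tube `Ψ′_B(S × B̄_R)` is measurable and
`μ_B|_{Ψ′_B(S × B̄_R)} = (Ψ′_B)_*((((vol ⊗ vol)|_{S × B̄_R})·J′)` with `J′(u,y) = (Π_i|c_i(u)|)·J_B(Ψ′_B(u,y))` — lit ✓`chart_comp_of_injOn_ofReal` applied to
✓`volume_withDensity_eq_map_gnoFibreBEquiv` (outer chart, `Ω = univ`, density `J_B`) and ✓`prod_volume_eq_map_diagScale` (fibrewise rescaling). [cite: Breitung1994, §2.3 Definitions 4–5] -/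
theorem volume_muB_restrict_scaledBTube_eq_map {S : Set (ℝ × ℝ)} (hS : MeasurableSet S) (R : ℝ) :
    MeasurableSet ((fun q : (ℝ × ℝ) × GnoFibreB L => gnoFibreBEquiv (q.1, gnoScaleB q.1 q.2)) '' (S ×ˢ closedBall (0 : GnoFibreB L) R)) ∧
    ((volume : Measure (ℝ × GnoCoord L)).withDensity (fun p => ENNReal.ofReal (((1 + p.1 ^ 2)⁻¹) ^ 2 * gnoDensity p.2))).restrict
        ((fun q : (ℝ × ℝ) × GnoFibreB L => gnoFibreBEquiv (q.1, gnoScaleB q.1 q.2)) '' (S ×ˢ closedBall (0 : GnoFibreB L) R)) =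
      ((((volume : Measure (ℝ × ℝ)).prod (volume : Measure (GnoFibreB L))).restrict (S ×ˢ closedBall (0 : GnoFibreB L) R)).withDensity
        (fun q => ENNReal.ofReal ((∏ i, |gnoFibreBScale (L := L) q.1 i|) *
          (((1 + (gnoFibreBEquiv (q.1, gnoScaleB q.1 q.2)).1 ^ 2)⁻¹) ^ 2 * gnoDensity (gnoFibreBEquiv (q.1, gnoScaleB q.1 q.2)).2)))).map
        (fun q : (ℝ × ℝ) × GnoFibreB L => gnoFibreBEquiv (q.1, gnoScaleB q.1 q.2)) := by
  classical
  set Φ : (ℝ × ℝ) × GnoFibreB L → (ℝ × ℝ) × GnoFibreB L :=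
    fun q => (q.1, (WithLp.toLp 2 fun i => gnoFibreBScale q.1 i * q.2 i : GnoFibreB L)) with hΦ
  have hc : ∀ i, Measurable fun u : ℝ × ℝ => gnoFibreBScale (L := L) u i := measurable_gnoFibreBScale
  have hc0 : ∀ (u : ℝ × ℝ) (i : GnoFibreBIdx L), gnoFibreBScale (L := L) u i ≠ 0 := fun u i => (gnoFibreBScale_pos u i).ne'
  have hΦm : Measurable Φ := QuantitativeLaplace.measurable_diagScale hc
  have hW : MeasurableSet (S ×ˢ closedBall (0 : GnoFibreB L) R) := hS.prod measurableSet_closedBall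
  have hΦW : MeasurableSet (Φ '' (S ×ˢ closedBall (0 : GnoFibreB L) R)) := measurableSet_image_diagScale hc hc0 hW
  have hEΦW : MeasurableSet (gnoFibreBEquiv '' (Φ '' (S ×ˢ closedBall (0 : GnoFibreB L) R))) :=
    (gnoFibreBEquiv (L := L)).measurableEmbedding.measurableSet_image.2 hΦW
  have hcomp : (fun q : (ℝ × ℝ) × GnoFibreB L => gnoFibreBEquiv (q.1, gnoScaleB q.1 q.2)) = (gnoFibreBEquiv (L := L)) ∘ Φ := rfl
  -- the outer chart, `Ω = univ`
  have hΘ : ((volume : Measure (ℝ × GnoCoord L)).withDensity (fun p => ENNReal.ofReal (((1 + p.1 ^ 2)⁻¹) ^ 2 * gnoDensity p.2))).restrict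
        (gnoFibreBEquiv '' (univ : Set ((ℝ × ℝ) × GnoFibreB L))) =
      ((((volume : Measure (ℝ × ℝ)).prod (volume : Measure (GnoFibreB L))).restrict univ).withDensity
        fun v => ENNReal.ofReal (((1 + (gnoFibreBEquiv v).1 ^ 2)⁻¹) ^ 2 * gnoDensity (gnoFibreBEquiv v).2)).map (gnoFibreBEquiv (L := L)) := by
    rw [image_univ_of_surjective (gnoFibreBEquiv (L := L)).surjective, Measure.restrict_univ, Measure.restrict_univ]
    exact volume_withDensity_eq_map_gnoFibreBEquiv (ENNReal.measurable_ofReal.comp measurable_bDensity)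
  -- the fibrewise rescaling chart
  have hΨ : ((volume : Measure (ℝ × ℝ)).prod (volume : Measure (GnoFibreB L))).restrict (Φ '' (S ×ˢ closedBall (0 : GnoFibreB L) R)) =
      ((((volume : Measure (ℝ × ℝ)).prod (volume : Measure (GnoFibreB L))).restrict (S ×ˢ closedBall (0 : GnoFibreB L) R)).withDensity
        fun q => ENNReal.ofReal (∏ i, |gnoFibreBScale (L := L) q.1 i|)).map Φ :=
    restrict_image_eq_map_of_eq_map hΦm (diagScale_injective hc0) (prod_volume_eq_map_diagScale (volume : Measure (ℝ × ℝ)) hc hc0) hW hΦW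
  have key := Literature.Analysis.Asymptotics.chart_comp_of_injOn_ofReal
    (μ := (volume : Measure (ℝ × GnoCoord L)).withDensity fun p => ENNReal.ofReal (((1 + p.1 ^ 2)⁻¹) ^ 2 * gnoDensity p.2))
    (κ := (volume : Measure (ℝ × ℝ)).prod (volume : Measure (GnoFibreB L))) (ν := (volume : Measure (ℝ × ℝ)).prod (volume : Measure (GnoFibreB L)))
    (Θ := gnoFibreBEquiv (L := L)) (Ω := univ) (J₁ := fun v => ((1 + (gnoFibreBEquiv v).1 ^ 2)⁻¹) ^ 2 * gnoDensity (gnoFibreBEquiv v).2) (Ψ := Φ)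
    (W := S ×ˢ closedBall (0 : GnoFibreB L) R) (J₂ := fun q => ∏ i, |gnoFibreBScale (L := L) q.1 i|)
    measurable_gnoFibreBEquiv hΦm (gnoFibreBEquiv (L := L)).injective.injOn (measurable_bDensity.comp measurable_gnoFibreBEquiv)
    (Finset.measurable_prod _ fun i _ => ((hc i).comp measurable_fst).abs) (fun q => Finset.prod_nonneg fun i _ => abs_nonneg _) (subset_univ _) hEΦW hΘ hΨ
  rw [hcomp]
  refine ⟨by rw [image_comp]; exact hEΦW, ?_⟩
  exact key

/-! ## §2 The packaged rescaled B-sockets -/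

/-- ★★★ **THE RESCALED B-SOCKETS** (principal signs `ε_z = +`, followers `+`; `0 < τ ≤ 1`): operators `A′_u = D_u A_u D_u` on `V_B` — symmetric, `(u,y) ↦ ⟪A′_u y,y⟫`
measurable, RAY identity, UNIFORM COERCIVITY `τ²∕((1+τ²)·12375·L¹⁰)·‖y‖² ≤ ⟪A′_u y,y⟫` on `{τ² ≤ |u|²}` —, the cubic datum `F_B(Ψ′_B(u,y)) − 0 = ½⟪A′_u y,y⟫ + ρ′(u,y)`,
`ρ′` measurable, `|ρ′(u,y)| ≤ 1136016L⁴‖gnoScaleB u y‖³` (plain letters), and the amplitude `(Π|c_i(u)|)·J_B(Ψ′_B(u,y))·1 = w₀(u)(1 + e′(u,y))`, `e′` measurable,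
`|e′| ≤ 2R‖y‖` on `‖y‖ ≤ R`, `w₀(u) = w(0,u₁,u₂)·√(1+|u|²)` — the `hA hcoer hAm hρm hem hf hw hη` of ✓`laplaceMethod_quantitative_fibred_chart_cubic_offBound_on` for `Ψ := Ψ′_B`.
[cite: Luscher1983, §2] [cite: Breitung1994, §2.3 Definitions 4–5] -/
theorem bFibre_rescaled_sockets (ε : GnoSign L) (hz : ε.2.1 = true) (hε : ε.2.2 = fun _ => true) {τ : ℝ} (hτ : 0 < τ) (hτ1 : τ ≤ 1) :
    ∃ A' : ℝ × ℝ → GnoFibreB L →ₗ[ℝ] GnoFibreB L, ∃ ρ' e' : (ℝ × ℝ) × GnoFibreB L → ℝ,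
      (∀ u, (A' u).IsSymmetric) ∧
      (Measurable fun q : (ℝ × ℝ) × GnoFibreB L => ⟪A' q.1 q.2, q.2⟫_ℝ) ∧ Measurable ρ' ∧ Measurable e' ∧
      (∀ u (y : GnoFibreB L), ⟪A' u y, y⟫_ℝ =
        iteratedDeriv 2 (fun s : ℝ => gnoDeficit (fun _ => false) (fun _ => 1) (hubAt (gnoBaseB u + s • gnoFibreBEmb (gnoScaleB u y)).1 1) ε
          (gnoBaseB u + s • gnoFibreBEmb (gnoScaleB u y)).2) 0) ∧
      (∀ u : ℝ × ℝ, τ ^ 2 ≤ u.1 ^ 2 + u.2 ^ 2 → ∀ y : GnoFibreB L, τ ^ 2 / ((1 + τ ^ 2) * (12375 * (L : ℝ) ^ 10)) * ‖y‖ ^ 2 ≤ ⟪A' u y, y⟫_ℝ) ∧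
      (∀ u (y : GnoFibreB L), gnoDeficit (fun _ => false) (fun _ => 1) (hubAt (gnoFibreBEquiv (u, gnoScaleB u y)).1 1) ε (gnoFibreBEquiv (u, gnoScaleB u y)).2 - 0 =
        (1 / 2) * ⟪A' u y, y⟫_ℝ + ρ' (u, y)) ∧
      (∀ u (y : GnoFibreB L), |ρ' (u, y)| ≤ 1136016 * (L : ℝ) ^ 4 * ‖gnoScaleB u y‖ ^ 3) ∧
      (∀ u (y : GnoFibreB L), (∏ i, |gnoFibreBScale (L := L) u i|) *
          (((1 + (gnoFibreBEquiv (u, gnoScaleB u y)).1 ^ 2)⁻¹) ^ 2 * gnoDensity (gnoFibreBEquiv (u, gnoScaleB u y)).2) * 1 =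
        gnomonicWeight (![0, u.1, u.2] : Fin 3 → ℝ) * Real.sqrt (1 + (u.1 ^ 2 + u.2 ^ 2)) * (1 + e' (u, y))) ∧
      (∀ R : ℝ, 0 ≤ R → ∀ u (y : GnoFibreB L), ‖y‖ ≤ R → |e' (u, y)| ≤ (2 * R) * ‖y‖) := by
  obtain ⟨A, hAs, -, hAyy, hray, hAm, -, -⟩ := exists_bFibreHessian (fun _ => false) (fun _ => 1) ε (L := L)
  have hD := fun u => gnoScaleBLin_isSymmetric (L := L) u
  -- the conjugated operators
  refine ⟨fun u => (gnoScaleBLin u).comp ((A (gnoBaseB u)).comp (gnoScaleBLin u)),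
    fun q => gnoDeficit (fun _ => false) (fun _ => 1) (hubAt (gnoFibreBEquiv (q.1, gnoScaleB q.1 q.2)).1 1) ε (gnoFibreBEquiv (q.1, gnoScaleB q.1 q.2)).2 -
      (1 / 2) * ⟪A (gnoBaseB q.1) (gnoScaleB q.1 q.2), gnoScaleB q.1 q.2⟫_ℝ,
    fun q => ((1 + (gnoFibreBEmb q.2).1 ^ 2)⁻¹) ^ 2 * gnoDensity (gnoFibreBEmb q.2).2 - 1, ?_⟩
  have hA'yy : ∀ u (y : GnoFibreB L), ⟪((gnoScaleBLin u).comp ((A (gnoBaseB u)).comp (gnoScaleBLin u))) y, y⟫_ℝ =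
      ⟪A (gnoBaseB u) (gnoScaleB u y), gnoScaleB u y⟫_ℝ := fun u y => by
    show ⟪gnoScaleBLin u (A (gnoBaseB u) (gnoScaleBLin u y)), y⟫_ℝ = _
    rw [hD u, gnoScaleBLin_apply]
  -- measurability of the conjugated form
  have hG : Measurable fun q : (ℝ × ℝ) × GnoFibreB L => ((gnoBaseB q.1 : ℝ × GnoCoord L), gnoScaleB q.1 q.2) :=
    (continuous_gnoBaseB.measurable.comp measurable_fst).prodMk (measurable_gnoScaleB_prod (L := L))
  have hAm' : Measurable fun q : (ℝ × ℝ) × GnoFibreB L => ⟪A (gnoBaseB q.1) (gnoScaleB q.1 q.2), gnoScaleB q.1 q.2⟫_ℝ := by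
    have e : (fun q : (ℝ × ℝ) × GnoFibreB L => ⟪A (gnoBaseB q.1) (gnoScaleB q.1 q.2), gnoScaleB q.1 q.2⟫_ℝ) =
        (fun q : (ℝ × GnoCoord L) × GnoFibreB L => ⟪A q.1 q.2, q.2⟫_ℝ) ∘ fun q : (ℝ × ℝ) × GnoFibreB L => ((gnoBaseB q.1 : ℝ × GnoCoord L), gnoScaleB q.1 q.2) := rfl
    rw [e]
    have h := Measurable.comp hAm hG
    exact h
  have hFm : Measurable fun q : (ℝ × ℝ) × GnoFibreB L =>
      gnoDeficit (fun _ => false) (fun _ => 1) (hubAt (gnoFibreBEquiv (q.1, gnoScaleB q.1 q.2)).1 1) ε (gnoFibreBEquiv (q.1, gnoScaleB q.1 q.2)).2 := by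
    have h := Measurable.comp (measurable_bDeficit (fun _ => false) (fun _ => 1) ε) (measurable_gnoScaleBChart (L := L))
    exact h
  have hEm : Measurable fun q : (ℝ × ℝ) × GnoFibreB L => ((1 + (gnoFibreBEmb q.2).1 ^ 2)⁻¹) ^ 2 * gnoDensity (gnoFibreBEmb q.2).2 := by
    have h := Measurable.comp measurable_bDensity ((gnoFibreBEmb (L := L)).continuous.measurable.comp (measurable_snd : Measurable fun q : (ℝ × ℝ) × GnoFibreB L => q.2))
    exact h
  refine ⟨?_, ?_, hFm.sub (measurable_const.mul hAm'), hEm.sub measurable_const, fun u y => ?_, fun u hu y => ?_, fun u y => ?_, fun u y => ?_,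
    fun u y => ?_, fun R hR u y hy => ?_⟩
  · -- symmetry of `D A D`
    intro u x y
    show ⟪gnoScaleBLin u (A (gnoBaseB u) (gnoScaleBLin u x)), y⟫_ℝ = ⟪x, gnoScaleBLin u (A (gnoBaseB u) (gnoScaleBLin u y))⟫_ℝ
    rw [hD u, hAs (gnoBaseB u), hD u]
  · -- measurability
    have e : (fun q : (ℝ × ℝ) × GnoFibreB L => ⟪((gnoScaleBLin q.1).comp ((A (gnoBaseB q.1)).comp (gnoScaleBLin q.1))) q.2, q.2⟫_ℝ) =
        fun q => ⟪A (gnoBaseB q.1) (gnoScaleB q.1 q.2), gnoScaleB q.1 q.2⟫_ℝ := funext fun q => hA'yy q.1 q.2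
    rw [e]; exact hAm'
  · -- the ray identity
    rw [hA'yy, hray]
  · -- uniform coercivity
    rw [hA'yy, hray]; exact bFibQ_gnoScaleB_ge ε hz hε hτ hτ1 u hu y
  · -- `hf`: an identity
    rw [hA'yy]; ring
  · -- `hρ`: the cubic datum in plain letters
    show |gnoDeficit (fun _ => false) (fun _ => 1) (hubAt (gnoFibreBEquiv (u, gnoScaleB u y)).1 1) ε (gnoFibreBEquiv (u, gnoScaleB u y)).2 -
        (1 / 2) * ⟪A (gnoBaseB u) (gnoScaleB u y), gnoScaleB u y⟫_ℝ| ≤ _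
    exact bFibreHessian_base_cubic ε hz hε hAyy u (gnoScaleB u y)
  · -- `hw`: the amplitude factorises
    show (∏ i, |gnoFibreBScale (L := L) u i|) * (((1 + (gnoFibreBEquiv (u, gnoScaleB u y)).1 ^ 2)⁻¹) ^ 2 * gnoDensity (gnoFibreBEquiv (u, gnoScaleB u y)).2) * 1 =
      gnomonicWeight (![0, u.1, u.2] : Fin 3 → ℝ) * Real.sqrt (1 + (u.1 ^ 2 + u.2 ^ 2)) * (1 + (((1 + (gnoFibreBEmb y).1 ^ 2)⁻¹) ^ 2 * gnoDensity (gnoFibreBEmb y).2 - 1))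
    rw [prod_abs_gnoFibreBScale, bDensity_rescaled_eq]; ring
  · -- `hη`: the amplitude defect
    show |((1 + (gnoFibreBEmb y).1 ^ 2)⁻¹) ^ 2 * gnoDensity (gnoFibreBEmb y).2 - 1| ≤ 2 * R * ‖y‖
    obtain ⟨h1, h2, -⟩ := bFibreWeight_bounds (L := L) y
    rw [abs_le]
    have hy0 := norm_nonneg y
    constructor <;> nlinarith [mul_le_mul_of_nonneg_left hy (by positivity : (0 : ℝ) ≤ 2 * ‖y‖)]

end Summit.QuantumFields.YangMills.Theorems.SwapVirialDeficit.BlowUpRing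

end
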